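import Summits.AtomisticToContinuum.BoseEinsteinCondensation.Theorems.BECGroundStateSOSPeriodicIRBoundWFComGap
import Summits.AtomisticToContinuum.BoseEinsteinCondensation.Theorems.BECProbeMassFlowCloudMomentumAtomProjectionTransfer
import Summits.AtomisticToContinuum.BoseEinsteinCondensation.Theorems.BECConjugateDominationHardCoreExtensionTruncationReduction
import Literature.MathematicalPhysics.QuantumManyBody.PeriodicMaxFormTranslation
import Literature.MathematicalPhysics.QuantumManyBody.PeriodicMaxFormZeroMomentum
import Literature.MathematicalPhysics.QuantumManyBody.PeriodicMaxFormGroundStates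
import Literature.MathematicalPhysics.QuantumManyBody.PeriodicFormCoreTrigPoly
import Literature.MathematicalPhysics.QuantumManyBody.PeriodicClusteringFromKyFanGap
import HarnessLib

/-!
# Route `BECProbeMassFlow`, crux `RecoilTransfer` (stmt-AtomisticToContinuum-12311):
# stub `stub_nearMinimisersNearZeroMomentum_of_invariant` (D′β)

Support file for the crux `RecoilTransfer` (line `registered`, skeleton `Lines/birth.lean` v6): the stub
`stub_nearMinimisersNearZeroMomentum_of_invariant` (exact registered name and signature). For a repulsive
finite-range `v` (hard walls allowed), `0 < L`, `M` bosons, finite `E₀ = periodicGroundStateEnergy v M L`: IF every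
element of the maximal-form ground-state class `maxFormGroundStates v M L ⊂ L²((ℝ/ℤ)^{3M})` is invariant under
the diagonal translations `translateLp b` (stub D′α, a HYPOTHESIS here), THEN `δ`-near-minimisers are `θ`-close
in `L²(cell)` to zero-total-momentum `δ'`-near-minimisers. No Ky Fan gap (the ground level may be degenerate).
All three steps use the FREE `L²((ℝ/ℤ)^{3M})` class `ιΩ = ι(graphEmbed Ω)` of `PeriodicFormDomain.lean`:
* **projection** (`normSq_sub_comProj_le`, `exists_zeroMomentum_near_of_near_invariant`): the centre-of-mass
  projection `PΩ = L⁻³∫_{[0,L)³} Ω(· + s𝟙) ds` (`WF.comProj`, total momentum `0`, `WF.comProj_pythagoras`: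
  `‖Ω‖² = ‖PΩ‖² + ‖Ω - PΩ‖²`, `𝓔_v[Ω] = 𝓔_v[PΩ] + 𝓔_v[Ω - PΩ]` for every measurable `v`) satisfies
  `‖Ω - PΩ‖²_{cell} ≤ ‖ιΩ - ξ‖²` for every translation-invariant class `ξ` (Parseval: `ι(Ω - PΩ)` has no
  zero-total-momentum modes, an invariant class has only such modes, `translateLp_eq_self_iff`); for
  `‖ιΩ - ξ‖² ≤ θ₁ < 1` the normalised projection `Ω₀ = PΩ/‖PΩ‖` has total momentum `0`,
  `periodicEnergy v Ω₀ ≤ (1 - θ₁)⁻¹ periodicEnergy v Ω` and `∫_{cell}‖Ω - Ω₀‖² ≤ 4θ₁`;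
* **compactness** (`exists_near_maxFormGroundStates`): near-minimisers are uniformly close to the ground-state
  class (the sibling crux's `exists_limitProfile_of_seq`: Rellich + Fatou + Beppo Levi, truncations `min(v,n) ≤ v`);
* **bookkeeping**: `θ₁ = min(θ/4, 1/2, q/2)`, `q(E₀ + 1) = s = min(δ', 1)/2`, `δ = min(δ₀(θ₁), s)`,
  `(1 - θ₁)⁻¹(E₀ + δ) ≤ (1 + 2θ₁)(E₀ + δ) ≤ E₀ + 2s ≤ E₀ + δ'`.
-/

noncomputable section

open MeasureTheory Filter UnitAddTorus
open scoped ENNReal NNReal InnerProductSpace ComplexConjugate Topology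

namespace Summit.AtomisticToContinuum.BoseEinsteinCondensation.Theorems

open Literature.MathematicalPhysics.QuantumManyBody Literature.MathematicalPhysics.QuantumManyBody.BoseGas
open Literature.Analysis.FunctionSpaces Literature.Analysis.OperatorTheory
open Summit.AtomisticToContinuum.BoseEinsteinCondensation.Cruxes.StaticResponseBound.UvThomsonForceWave
  (measurable_zeroProfile lintegral_periodicInteraction_zero_ne_top periodicEnergy_truncPotential_le')
open Summit.AtomisticToContinuum.BoseEinsteinCondensation.Cruxes.HardCoreExtension.ThirdLawCurrentFloor
  (exists_limitProfile_of_seq)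
open Summit.AtomisticToContinuum.BoseEinsteinCondensation.Cruxes.PeriodicIRBound.LinearPhFloorWagner.WF
open Summit.AtomisticToContinuum.BoseEinsteinCondensation.Cruxes.CloudMomentumAtom.Birth
  (inner_comProj_eq_of_invariant)

-- The measure on `ℝ/ℤ` is the Haar PROBABILITY measure, as in `PeriodicFormDomain.lean` and every
-- maximal-form file of the tree (`maxFormGroundStates`, `translateLp` live on `Lp ℂ 2 volume`).
attribute [local instance] Literature.MathematicalPhysics.QuantumManyBody.BoseGas.formDomain_measureSpace
  Literature.MathematicalPhysics.QuantumManyBody.BoseGas.formDomain_isProbabilityMeasure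
  Literature.MathematicalPhysics.QuantumManyBody.BoseGas.formDomain_isProbabilityMeasure_pi

variable {M : ℕ} {L : ℝ}

/-- Local notation for the Hilbert space `L²((ℝ/ℤ)^{3M})`, as in `PeriodicFormDomain.lean`. -/
local notation "L2T " N':max => Lp ℂ 2 (volume : Measure (UnitAddTorus (Fin N' × Fin 3)))

/-- Local notation: the FREE `L²((ℝ/ℤ)^{3M})` class `ι(graphEmbed Ψ)` of a core function `Ψ`. -/
local notation "ιc[" hL ", " Ψ "]" =>
  formEmbed hL measurable_zeroProfile (lintegral_periodicInteraction_zero_ne_top _ _)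
    (Subtype.mk (graphEmbed hL measurable_zeroProfile (lintegral_periodicInteraction_zero_ne_top _ _) Ψ)
      (graphEmbed_mem_formDomain _ _ _ _))

/-- `ι(a) - ι(b) = ι(a - b)` on the core. [folklore] -/
theorem formEmbed_graphEmbed_sub (hL : 0 < L) (a b : periodicCore M L) :
    ιc[hL, a] - ιc[hL, b] = ιc[hL, a - b] := by
  rw [← map_sub]
  congr 1
  apply Subtype.ext
  simp only [Submodule.coe_sub, map_sub]

/-- **A periodic function of total momentum `0` has no Fourier modes of non-zero total momentum**:
`ĉₙ(f) = e_{∑ᵢ n(i,·)}(b) ĉₙ(f)` for every `b ∈ (ℝ/ℤ)³` (translate by `s = L b`), and `∫ e_m(b) db = 0`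
for `m ≠ 0`. [folklore] -/
theorem configFourierCoeff_eq_zero_of_hasTotalMomentum_zero (hL : 0 < L) {f : Config M → ℂ}
    (hper : IsTorusPeriodic L f) (h0 : HasTotalMomentum 0 f) {n : Fin M × Fin 3 → ℤ}
    (hn : (fun k => ∑ i, n (i, k)) ≠ 0) : configFourierCoeff L f n = 0 := by
  have hb : ∀ b : UnitAddTorus (Fin 3),
      mFourier (fun k => ∑ i, n (i, k)) b * configFourierCoeff L f n = configFourierCoeff L f n := by
    intro b
    have hinv : (fun X => f (X + fun _ => fromUnitTorus L b)) = f :=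
      funext fun X => (hasTotalMomentum_zero_iff.1 h0) (fromUnitTorus L b) X
    have h1 := configFourierCoeff_translate hL hper (fun _ : Fin M => fromUnitTorus L b) n
    have h2 : toUnitTorusN L (fun _ : Fin M => fromUnitTorus L b) = diagShift M b := by
      funext p
      show toUnitTorus L (fromUnitTorus L b) p.2 = b p.2
      rw [toUnitTorus_fromUnitTorus hL.ne']
    rw [hinv, h2, mFourier_diagShift] at h1
    exact h1.symm
  have hint := congrArg (fun F : UnitAddTorus (Fin 3) → ℂ => ∫ b, F b) (funext hb)
  simp only [integral_mul_const, integral_const, probReal_univ, one_smul, integral_mFourier_eq_ite,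
    if_neg hn, zero_mul] at hint
  exact hint.symm

/-- **`PΩ` and `Ω` have the same Fourier modes of zero total momentum**: for `∑ᵢ n(i,·) = 0` the plane
wave `eₙ` is invariant under simultaneous translation of all particles, so `∫ conj(eₙ) PΩ = ∫ conj(eₙ) Ω`
(`inner_comProj_eq_of_invariant`). [folklore] -/
theorem inner_mFourierLp_formEmbed_comProj_eq (hL : 0 < L) (Ω : PeriodicTrialState M L)
    {n : Fin M × Fin 3 → ℤ} (hn : (fun k => ∑ i, n (i, k)) = 0) (hP : comProj L Ω.ψ ∈ periodicCore M L) :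
    ⟪(mFourierLp 2 n : L2T M), ιc[hL, ⟨comProj L Ω.ψ, hP⟩]⟫_ℂ =
      ⟪(mFourierLp 2 n : L2T M), ιc[hL, ⟨Ω.ψ, Ω.mem_periodicCore⟩]⟫_ℂ := by
  rw [inner_mFourierLp_formEmbed_graphEmbed, inner_mFourierLp_formEmbed_graphEmbed]
  congr 1
  change configFourierCoeff L (comProj L Ω.ψ) n = configFourierCoeff L Ω.ψ n
  rw [configFourierCoeff_eq_integral hL hP.1.continuous.aestronglyMeasurable,
    configFourierCoeff_eq_integral hL Ω.contDiff.continuous.aestronglyMeasurable]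
  congr 1
  exact inner_comProj_eq_of_invariant hL (continuous_cellWaveN L n) (cellWaveN_periodic hL.ne' n)
    (fun X s => cellWaveN_translate_of_totalMomentum_eq_zero L hn X s) Ω.contDiff.continuous Ω.periodic

/-- **`‖Ω - PΩ‖²_{cell} ≤ ‖ιΩ - ξ‖²` for every translation-invariant class `ξ`.** `ι(Ω - PΩ)` has no
zero-total-momentum modes, an invariant class has ONLY such modes (`translateLp_eq_self_iff`), so they are
orthogonal (Parseval); `ι(PΩ) - ξ` is invariant, and `‖ιΩ - ξ‖² = ‖ι(Ω - PΩ)‖² + ‖ι(PΩ) - ξ‖²`. [folklore] -/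
theorem normSq_sub_comProj_le (hL : 0 < L) (Ω : PeriodicTrialState M L) (ξ : L2T M)
    (hξ : ∀ b : UnitAddTorus (Fin 3), translateLp b ξ = ξ) :
    normSq L (fun X => Ω.ψ X - comProj L Ω.ψ X) ≤
      ENNReal.ofReal (‖ιc[hL, ⟨Ω.ψ, Ω.mem_periodicCore⟩] - ξ‖ ^ 2) := by
  obtain ⟨hPc, hP0⟩ := isCore_comProj hL (isCore_trialState Ω)
  have hPmem : comProj L Ω.ψ ∈ periodicCore M L := ⟨hPc.contDiff, hPc.periodic, hPc.symm⟩
  -- the embedded classes `xΩ = ιΩ`, `xP = ι(PΩ)`, `xg = ι(Ω - PΩ)`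
  obtain ⟨xΩ, hxΩ⟩ : ∃ x : L2T M, x = ιc[hL, ⟨Ω.ψ, Ω.mem_periodicCore⟩] := ⟨_, rfl⟩
  obtain ⟨xP, hxP⟩ : ∃ x : L2T M, x = ιc[hL, ⟨comProj L Ω.ψ, hPmem⟩] := ⟨_, rfl⟩
  obtain ⟨xg, hxg⟩ : ∃ x : L2T M,
      x = ιc[hL, (⟨Ω.ψ, Ω.mem_periodicCore⟩ : periodicCore M L) - ⟨comProj L Ω.ψ, hPmem⟩] := ⟨_, rfl⟩
  have hsub : xΩ - xP = xg := hxΩ ▸ hxP ▸ hxg ▸ formEmbed_graphEmbed_sub hL _ _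
  have hg_norm : ‖xg‖ ^ 2 = (normSq L (fun X => Ω.ψ X - comProj L Ω.ψ X)).toReal :=
    hxg ▸ norm_formEmbed_graphEmbed_sq hL _ _ _
  -- the Fourier modes
  have hcoefP : ∀ n : Fin M × Fin 3 → ℤ, (fun k => ∑ i, n (i, k)) ≠ 0 →
      ⟪(mFourierLp 2 n : L2T M), xP⟫_ℂ = 0 := fun n hn => by
    rw [hxP, inner_mFourierLp_formEmbed_graphEmbed]
    change (cellScale M L : ℂ) * configFourierCoeff L (comProj L Ω.ψ) n = 0
    rw [configFourierCoeff_eq_zero_of_hasTotalMomentum_zero hL hPc.periodic hP0 hn, mul_zero]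
  have hcoefg : ∀ n : Fin M × Fin 3 → ℤ, (fun k => ∑ i, n (i, k)) = 0 →
      ⟪(mFourierLp 2 n : L2T M), xg⟫_ℂ = 0 := fun n hn => by
    rw [← hsub, inner_sub_right, hxΩ, hxP, inner_mFourierLp_formEmbed_comProj_eq hL Ω hn hPmem, sub_self]
  -- `ι(PΩ) - ξ` is invariant, hence orthogonal to `xg` (Parseval)
  have hPinv : ∀ b : UnitAddTorus (Fin 3), translateLp b xP = xP := (translateLp_eq_self_iff xP).2 hcoefP
  have hζ : ∀ b : UnitAddTorus (Fin 3), translateLp b (xP - ξ) = xP - ξ := fun b => by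
    rw [map_sub, hPinv b, hξ b]
  have horth : ⟪xg, xP - ξ⟫_ℂ = 0 := by
    have h := hasSum_conj_inner_mul_inner xg (xP - ξ)
    have h0 : (fun n : Fin M × Fin 3 → ℤ =>
        conj ⟪(mFourierLp 2 n : L2T M), xg⟫_ℂ * ⟪(mFourierLp 2 n : L2T M), xP - ξ⟫_ℂ) = fun _ => 0 := by
      funext n
      by_cases hn : (fun k => ∑ i, n (i, k)) = 0
      · rw [hcoefg n hn, map_zero, zero_mul]
      · rw [(translateLp_eq_self_iff _).1 hζ n hn, mul_zero]
    rw [h0] at h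
    exact h.unique hasSum_zero
  -- Pythagoras
  have hdecomp : xΩ - ξ = xg + (xP - ξ) := by rw [← hsub]; abel
  have hpy := norm_add_sq_eq_norm_sq_add_norm_sq_of_inner_eq_zero (𝕜 := ℂ) xg (xP - ξ) horth
  have hle : ‖xg‖ ^ 2 ≤ ‖xΩ - ξ‖ ^ 2 := by
    rw [hdecomp, sq, sq, hpy]
    nlinarith [norm_nonneg (xP - ξ)]
  have htop : normSq L (fun X => Ω.ψ X - comProj L Ω.ψ X) ≠ ⊤ :=
    (lintegral_cellN_sq_lt_top L (Ω.contDiff.continuous.sub hPc.contDiff.continuous)).ne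
  rw [← hxΩ, ← ENNReal.ofReal_toReal htop, ← hg_norm]
  exact ENNReal.ofReal_le_ofReal hle

/-- **Normalising constructor with a POSITIVE constant** (the tree's `exists_periodicTrialState_const_mul`
with the sign exposed): `a u`, `a = ‖u‖_{cell}⁻¹ > 0`, is a trial state and `|a|² = (‖u‖²_{cell})⁻¹`. [folklore] -/
theorem exists_periodicTrialState_pos_mul {u : Config M → ℂ} (hu : ContDiff ℝ 1 u)
    (hper : IsTorusPeriodic L u) (hsymm : IsSymm u) (h0 : normSq L u ≠ 0) (htop : normSq L u ≠ ⊤) :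
    ∃ (Ψ : PeriodicTrialState M L) (a : ℝ), 0 < a ∧ (Ψ.ψ = fun X => (a : ℂ) * u X) ∧
      ((‖(a : ℂ)‖₊ : ℝ≥0∞)) ^ 2 = (normSq L u)⁻¹ := by
  -- adapted from `exists_periodicTrialState_const_mul` (PeriodicClusteringFromKyFanGap.lean)
  have hIpos : 0 < (normSq L u).toReal := ENNReal.toReal_pos h0 htop
  set a : ℝ := (Real.sqrt (normSq L u).toReal)⁻¹ with ha_def
  have ha0 : 0 < a := by positivity
  have ha : ((‖(a : ℂ)‖₊ : ℝ≥0∞)) ^ 2 = (normSq L u)⁻¹ := by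
    rw [coe_nnnorm_sq_eq_ofReal, Complex.norm_real, Real.norm_of_nonneg ha0.le, ha_def, inv_pow,
      Real.sq_sqrt hIpos.le, ENNReal.ofReal_inv_of_pos hIpos, ENNReal.ofReal_toReal htop]
  refine ⟨⟨fun X => (a : ℂ) * u X, contDiff_const.mul hu,
    fun X i k => by simp only [hper X i k], fun σ X => by simp only [hsymm σ X], ?_⟩, a, ha0, rfl, ha⟩
  show ∫⁻ X in cellN M L, ((‖(a : ℂ) * u X‖₊ : ℝ≥0∞)) ^ 2 = 1
  rw [lintegral_cellN_sq_const_mul, ha]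
  exact ENNReal.inv_mul_cancel h0 htop

/-- **The normalised zero-momentum projection of a trial state near an invariant class** (measurable `v`, hard
cores allowed): if `‖ιΩ - ξ‖² ≤ θ₁ < 1` for a class `ξ` invariant under all diagonal translations, `Ω₀ = PΩ/‖PΩ‖`
is a Bose trial state of total momentum `0` with `periodicEnergy v Ω₀ ≤ (1 - θ₁)⁻¹ periodicEnergy v Ω`
(`𝓔[PΩ] ≤ 𝓔[Ω]`, `‖PΩ‖² = 1 - ‖Ω - PΩ‖² ≥ 1 - θ₁`) and `∫_{cell}‖Ω - Ω₀‖² ≤ 4θ₁`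
(`‖Ω - PΩ‖ ≤ √θ₁`, `‖PΩ - Ω₀‖ = 1 - ‖PΩ‖ ≤ θ₁`). [folklore] -/
theorem exists_zeroMomentum_near_of_near_invariant {v : ℝ → ℝ≥0∞} (hv : Measurable v) (hL : 0 < L)
    (Ω : PeriodicTrialState M L) (ξ : L2T M) (hξ : ∀ b : UnitAddTorus (Fin 3), translateLp b ξ = ξ)
    {θ₁ : ℝ} (hθ0 : 0 ≤ θ₁) (hθ1 : θ₁ < 1) (hdist : ‖ιc[hL, ⟨Ω.ψ, Ω.mem_periodicCore⟩] - ξ‖ ^ 2 ≤ θ₁) :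
    ∃ Ω₀ : PeriodicTrialState M L, HasTotalMomentum 0 Ω₀.ψ ∧
      periodicEnergy v Ω₀ ≤ (ENNReal.ofReal (1 - θ₁))⁻¹ * periodicEnergy v Ω ∧
      ∫ X in cellN M L, ‖Ω.ψ X - Ω₀.ψ X‖ ^ 2 ≤ 4 * θ₁ := by
  obtain ⟨hPc, hP0⟩ := isCore_comProj hL (isCore_trialState Ω)
  have hPmem : comProj L Ω.ψ ∈ periodicCore M L := ⟨hPc.contDiff, hPc.periodic, hPc.symm⟩
  obtain ⟨hnorm, hq⟩ := comProj_pythagoras hL hv (isCore_trialState Ω)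
  have h1 : normSq L Ω.ψ = 1 := Ω.norm_eq
  have hg_le : normSq L (fun X => Ω.ψ X - comProj L Ω.ψ X) ≤ ENNReal.ofReal θ₁ :=
    (normSq_sub_comProj_le hL Ω ξ hξ).trans (ENNReal.ofReal_le_ofReal hdist)
  -- `‖PΩ‖² ≥ 1 - θ₁ > 0`
  have hP_ge : ENNReal.ofReal (1 - θ₁) ≤ normSq L (comProj L Ω.ψ) := by
    rw [ENNReal.ofReal_sub _ hθ0, ENNReal.ofReal_one]
    refine tsub_le_iff_right.2 ?_
    calc (1 : ℝ≥0∞) = normSq L (comProj L Ω.ψ) + normSq L (fun X => Ω.ψ X - comProj L Ω.ψ X) :=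
          h1.symm.trans hnorm
      _ ≤ normSq L (comProj L Ω.ψ) + ENNReal.ofReal θ₁ := add_le_add le_rfl hg_le
  have hpos : 0 < ENNReal.ofReal (1 - θ₁) := ENNReal.ofReal_pos.2 (by linarith)
  have hPle1 : normSq L (comProj L Ω.ψ) ≤ 1 := by rw [← h1, hnorm]; exact le_self_add
  have hPtop : normSq L (comProj L Ω.ψ) ≠ ⊤ := ne_top_of_le_ne_top ENNReal.one_ne_top hPle1
  obtain ⟨Ω₀, a, ha0, hΩ₀, ha⟩ :=
    exists_periodicTrialState_pos_mul hPc.contDiff hPc.periodic hPc.symm (hpos.trans_le hP_ge).ne' hPtop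
  refine ⟨Ω₀, by rw [hΩ₀]; exact hP0.const_mul _, ?_, ?_⟩
  · -- the energy
    calc periodicEnergy v Ω₀ = ((‖(a : ℂ)‖₊ : ℝ≥0∞)) ^ 2 * qform v L (comProj L Ω.ψ) := by
          rw [periodicEnergy, hΩ₀]
          exact lintegral_periodicEnergy_const_mul v L _ hPc.contDiff
      _ ≤ (normSq L (comProj L Ω.ψ))⁻¹ * qform v L Ω.ψ := by
          rw [ha]
          exact mul_le_mul' le_rfl (by rw [hq]; exact le_self_add)
      _ ≤ (ENNReal.ofReal (1 - θ₁))⁻¹ * periodicEnergy v Ω := mul_le_mul' (ENNReal.inv_le_inv.2 hP_ge) le_rfl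
  · -- the distance, computed in `L²((ℝ/ℤ)^{3M})`
    obtain ⟨xΩ, hxΩ⟩ : ∃ x : L2T M, x = ιc[hL, ⟨Ω.ψ, Ω.mem_periodicCore⟩] := ⟨_, rfl⟩
    obtain ⟨xP, hxP⟩ : ∃ x : L2T M, x = ιc[hL, ⟨comProj L Ω.ψ, hPmem⟩] := ⟨_, rfl⟩
    obtain ⟨xΩ₀, hxΩ₀⟩ : ∃ x : L2T M, x = ιc[hL, ⟨Ω₀.ψ, Ω₀.mem_periodicCore⟩] := ⟨_, rfl⟩
    have hxΩ₀a : xΩ₀ = (a : ℂ) • xP := by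
      have hsm : (⟨Ω₀.ψ, Ω₀.mem_periodicCore⟩ : periodicCore M L) = (a : ℂ) • ⟨comProj L Ω.ψ, hPmem⟩ := by
        apply Subtype.ext
        show Ω₀.ψ = (a : ℂ) • comProj L Ω.ψ
        rw [hΩ₀]
        funext X
        simp only [Pi.smul_apply, smul_eq_mul]
      rw [hxΩ₀, hsm, hxP, ← map_smul]
      congr 1
      apply Subtype.ext
      simp only [Submodule.coe_smul, map_smul]
    have hnΩ₀ : ‖xΩ₀‖ = 1 := hxΩ₀ ▸ norm_formEmbed_graphEmbed_trialState hL _ _ Ω₀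
    have hnP_sq : ‖xP‖ ^ 2 = (normSq L (comProj L Ω.ψ)).toReal := hxP ▸ norm_formEmbed_graphEmbed_sq hL _ _ _
    have hnP_ge : 1 - θ₁ ≤ ‖xP‖ ^ 2 := hnP_sq ▸ (ENNReal.ofReal_le_iff_le_toReal hPtop).1 hP_ge
    have hnP_le : ‖xP‖ ^ 2 ≤ 1 := by
      rw [hnP_sq, ← ENNReal.toReal_one]
      exact ENNReal.toReal_mono ENNReal.one_ne_top hPle1
    have hnP1 : ‖xP‖ ≤ 1 := by nlinarith [norm_nonneg xP]
    -- `‖xΩ - xP‖² ≤ θ₁` and `‖xP - xΩ₀‖ = 1 - ‖xP‖ ≤ θ₁`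
    have hd1 : ‖xΩ - xP‖ ^ 2 ≤ θ₁ := by
      rw [hxΩ, hxP, formEmbed_graphEmbed_sub hL, norm_formEmbed_graphEmbed_sq]
      exact ENNReal.toReal_le_of_le_ofReal hθ0 hg_le
    have haP : a * ‖xP‖ = 1 := by
      rw [← hnΩ₀, hxΩ₀a, norm_smul, Complex.norm_real, Real.norm_of_nonneg ha0.le]
    have hd2 : ‖xP - xΩ₀‖ ≤ θ₁ := by
      have h' : xP - xΩ₀ = ((1 - a : ℝ) : ℂ) • xP := by
        rw [hxΩ₀a, Complex.ofReal_sub, Complex.ofReal_one, sub_smul, one_smul]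
      have h4 : ‖xP - xΩ₀‖ = |‖xP‖ - a * ‖xP‖| := by
        rw [h', norm_smul, Complex.norm_real, Real.norm_eq_abs, ← abs_of_nonneg (norm_nonneg xP), ← abs_mul,
          abs_of_nonneg (norm_nonneg xP)]
        ring_nf
      rw [h4, haP, abs_sub_comm, abs_of_nonneg (by linarith)]
      nlinarith [norm_nonneg xP]
    have hsq : ‖xΩ - xΩ₀‖ ^ 2 ≤ 4 * θ₁ := by
      have h5 : ‖xΩ - xΩ₀‖ ^ 2 ≤ (‖xΩ - xP‖ + ‖xP - xΩ₀‖) ^ 2 :=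
        pow_le_pow_left₀ (norm_nonneg _) (norm_sub_le_norm_sub_add_norm_sub _ _ _) 2
      nlinarith [norm_nonneg (xΩ - xP), norm_nonneg (xP - xΩ₀), sq_nonneg (‖xΩ - xP‖ - ‖xP - xΩ₀‖),
        mul_le_mul hd2 hd2 (norm_nonneg _) hθ0]
    have hcont : Continuous fun X => Ω.ψ X - Ω₀.ψ X := Ω.contDiff.continuous.sub Ω₀.contDiff.continuous
    have hint : ∫ X in cellN M L, ‖Ω.ψ X - Ω₀.ψ X‖ ^ 2 = ‖xΩ - xΩ₀‖ ^ 2 := by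
      rw [integral_cellN_norm_sq_eq_toReal L hcont, hxΩ, hxΩ₀, formEmbed_graphEmbed_sub hL,
        norm_formEmbed_graphEmbed_sq]
      rfl
    exact hint ▸ hsq

/-- **Near-minimisers are uniformly close to the maximal-form ground-state class** (measurable `v`, hard cores
allowed, `L > 0`, finite `E₀`): for `θ₁ > 0` some `δ > 0` puts the free class of every `δ`-near-minimiser within
`θ₁` (squared) of `maxFormGroundStates v M L`. Otherwise `1/(n+1)`-near-minimisers `θ₁`-far from the class have
(`exists_limitProfile_of_seq`, truncations `min(v, n) ≤ v`) a subsequence converging to a unit Bose-symmetric `η` of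
maximal-form energy `≤ E₀ + 1/(m+1)` for all `m` (same lemma on the tails), i.e. in the class. [folklore] -/
theorem exists_near_maxFormGroundStates {v : ℝ → ℝ≥0∞} (hv : Measurable v) (hL : 0 < L)
    (hE : periodicGroundStateEnergy v M L ≠ ⊤) {θ₁ : ℝ} (hθ₁ : 0 < θ₁) :
    ∃ δ : ℝ≥0∞, 0 < δ ∧ ∀ Ω : PeriodicTrialState M L,
      periodicEnergy v Ω ≤ periodicGroundStateEnergy v M L + δ →
        ∃ ξ ∈ maxFormGroundStates v M L, ‖ιc[hL, ⟨Ω.ψ, Ω.mem_periodicCore⟩] - ξ‖ ^ 2 ≤ θ₁ := by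
  by_contra hcon
  push Not at hcon
  have hδn : ∀ n : ℕ, (0 : ℝ≥0∞) < ((n : ℝ≥0∞) + 1)⁻¹ := fun n =>
    ENNReal.inv_pos.2 (ENNReal.add_ne_top.2 ⟨ENNReal.natCast_ne_top n, ENNReal.one_ne_top⟩)
  choose Ω hΩE hΩfar using fun n : ℕ => hcon _ (hδn n)
  -- one compactness extraction at the level `E₀ + 1`
  have hB1 : periodicGroundStateEnergy v M L + 1 ≠ ⊤ := ENNReal.add_ne_top.2 ⟨hE, ENNReal.one_ne_top⟩
  have hB : ∀ n, periodicEnergy (truncPotential v n) (Ω n) ≤ periodicGroundStateEnergy v M L + 1 := fun n =>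
    (periodicEnergy_truncPotential_le' v n (Ω n)).trans
      ((hΩE n).trans (add_le_add le_rfl (ENNReal.inv_le_one.2 le_add_self)))
  obtain ⟨η, φ, hφ, hconv, hη1, hηsymm, -⟩ := exists_limitProfile_of_seq hv hL hB1 Ω hB
  -- the limit has maximal-form energy `≤ E₀ + 1/(m+1)` for every `m` (same extraction on the tails)
  have hQm : ∀ m : ℕ, maxForm v L η ≤ periodicGroundStateEnergy v M L + ((m : ℝ≥0∞) + 1)⁻¹ := by
    intro m
    have hBm_top : periodicGroundStateEnergy v M L + ((m : ℝ≥0∞) + 1)⁻¹ ≠ ⊤ :=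
      ENNReal.add_ne_top.2 ⟨hE, ENNReal.inv_ne_top.2 (by positivity)⟩
    have hBm : ∀ i, periodicEnergy (truncPotential v i) (Ω (φ (i + m))) ≤
        periodicGroundStateEnergy v M L + ((m : ℝ≥0∞) + 1)⁻¹ := by
      intro i
      refine (periodicEnergy_truncPotential_le' v i _).trans ((hΩE _).trans (add_le_add le_rfl ?_))
      have him : m ≤ φ (i + m) := (Nat.le_add_left m i).trans hφ.le_apply
      gcongr
    obtain ⟨η', φ', hφ', hconv', -, -, hQ'⟩ :=
      exists_limitProfile_of_seq hv hL hBm_top (fun i => Ω (φ (i + m))) hBm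
    have hconv'' : Tendsto (fun i => ιc[hL, ⟨(Ω (φ (φ' i + m))).ψ, (Ω (φ (φ' i + m))).mem_periodicCore⟩])
        atTop (𝓝 η) :=
      hconv.comp ((tendsto_add_atTop_nat m).comp hφ'.tendsto_atTop)
    rw [tendsto_nhds_unique hconv' hconv''] at hQ'
    exact hQ'
  have hQ0 : maxForm v L η ≤ periodicGroundStateEnergy v M L := by
    refine ENNReal.le_of_forall_pos_le_add fun ε hε _ => ?_
    obtain ⟨m, hm⟩ := ENNReal.exists_inv_nat_lt (a := (ε : ℝ≥0∞)) (by exact_mod_cast hε.ne')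
    exact (hQm m).trans (add_le_add le_rfl ((ENNReal.inv_le_inv.2 le_self_add).trans hm.le))
  have hηM : η ∈ maxFormGroundStates v M L := by
    refine ⟨mem_boseSymmetric.2 hηsymm, ?_⟩
    rw [hη1, one_pow, ENNReal.ofReal_one, mul_one]
    exact hQ0
  -- contradiction along the convergent subsequence
  have hev : ∀ᶠ i in atTop, ‖ιc[hL, ⟨(Ω (φ i)).ψ, (Ω (φ i)).mem_periodicCore⟩] - η‖ < Real.sqrt θ₁ :=
    (tendsto_iff_norm_sub_tendsto_zero.1 hconv).eventually_lt_const (Real.sqrt_pos.2 hθ₁)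
  obtain ⟨i, hi⟩ := hev.exists
  have h := pow_lt_pow_left₀ hi (norm_nonneg _) two_ne_zero
  rw [Real.sq_sqrt hθ₁.le] at h
  exact lt_irrefl _ ((hΩfar (φ i) η hηM).trans h)

/-- **Stub D′β `stub_nearMinimisersNearZeroMomentum_of_invariant` of crux `RecoilTransfer` (route
`BECProbeMassFlow`), exact registered signature: near-minimisers are `L²`-close to zero-total-momentum
near-minimisers, GIVEN that the maximal-form ground-state class is translation invariant** (all repulsive
finite-range profiles, hard walls included; fixed `(M, L)`; no Ky Fan gap): a `δ`-near-minimiser is `θ₁`-close to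
some `ξ` in the class (`exists_near_maxFormGroundStates`), invariant by hypothesis, and its normalised centre-of-mass
projection (`exists_zeroMomentum_near_of_near_invariant`) does the job for `θ₁ = min(θ/4, 1/2, q/2)`,
`q(E₀ + 1) = s = min(δ', 1)/2`, `δ = min(δ₀, s)`. [cite: ReedSimonIV1978, Thm XIII.64, §XIII.16] -/
theorem stub_nearMinimisersNearZeroMomentum_of_invariant :
    ∀ v : ℝ → ℝ≥0∞, IsRepulsiveFiniteRange v → ∀ R₀ : ℝ, (∀ r : ℝ, R₀ < r → v r = 0) →
      ∀ (M : ℕ) (L : ℝ), 0 < L → 2 * R₀ < L → periodicGroundStateEnergy v M L ≠ ⊤ →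
        (∀ η : Lp ℂ 2 (volume : Measure (UnitAddTorus (Fin M × Fin 3))),
          η ∈ maxFormGroundStates v M L → ∀ b : UnitAddTorus (Fin 3), translateLp b η = η) →
        ∀ θ : ℝ, 0 < θ → ∀ δ' : ℝ≥0∞, 0 < δ' → ∃ δ : ℝ≥0∞, 0 < δ ∧
          ∀ Ω : PeriodicTrialState M L,
            periodicEnergy v Ω ≤ periodicGroundStateEnergy v M L + δ →
              ∃ Ω₀ : PeriodicTrialState M L, HasTotalMomentum 0 Ω₀.ψ ∧
                periodicEnergy v Ω₀ ≤ periodicGroundStateEnergy v M L + δ' ∧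
                ∫ X in cellN M L, ‖Ω.ψ X - Ω₀.ψ X‖ ^ 2 ≤ θ := by
  intro v hv R₀ _ M L hL _ hE hinv θ hθ δ' hδ'
  -- the slack unit `s = min δ' 1 / 2` and the relative budget `q = s / (E₀ + 1)`
  set s : ℝ≥0∞ := min δ' 1 / 2 with hs
  have hspos : 0 < s := ENNReal.div_pos (lt_min hδ' one_pos).ne' (by norm_num)
  have hstop : s ≠ ⊤ :=
    ENNReal.div_ne_top (ne_top_of_le_ne_top ENNReal.one_ne_top (min_le_right _ _)) (by norm_num)
  have hs1 : s ≤ 1 := ENNReal.half_le_self.trans (min_le_right _ _)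
  set K : ℝ≥0∞ := periodicGroundStateEnergy v M L + 1 with hK
  have hKtop : K ≠ ⊤ := ENNReal.add_ne_top.2 ⟨hE, ENNReal.one_ne_top⟩
  have hK0 : K ≠ 0 := (lt_of_lt_of_le one_pos le_add_self).ne'
  set q : ℝ≥0∞ := s / K with hq
  have hqtop : q ≠ ⊤ := ENNReal.div_ne_top hstop hK0
  have hqpos : 0 < q := ENNReal.div_pos hspos.ne' hKtop
  have hqr : 0 < q.toReal := ENNReal.toReal_pos hqpos.ne' hqtop
  -- the closeness scale `θ₁`
  set θ₁ : ℝ := min (θ / 4) (min (1 / 2) (q.toReal / 2)) with hθ₁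
  have hθ₁pos : 0 < θ₁ := lt_min (by positivity) (lt_min (by norm_num) (by positivity))
  have hθ₁θ : 4 * θ₁ ≤ θ := by linarith [min_le_left (θ / 4) (min (1 / 2) (q.toReal / 2))]
  have hθ₁half : θ₁ ≤ 1 / 2 := (min_le_right _ _).trans (min_le_left _ _)
  have hθ₁q : 2 * θ₁ ≤ q.toReal := by
    linarith [(min_le_right (θ / 4) _).trans (min_le_right (1 / 2 : ℝ) (q.toReal / 2))]
  -- compactness at scale `θ₁`, then the zero-momentum projection
  obtain ⟨δ₀, hδ₀, hnear⟩ := exists_near_maxFormGroundStates (M := M) hv.1 hL hE hθ₁pos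
  refine ⟨min δ₀ s, lt_min hδ₀ hspos, fun Ω hΩ => ?_⟩
  obtain ⟨ξ, hξM, hdist⟩ := hnear Ω (hΩ.trans (add_le_add le_rfl (min_le_left _ _)))
  obtain ⟨Ω₀, hQ0, hEΩ₀, hd⟩ := exists_zeroMomentum_near_of_near_invariant hv.1 hL Ω ξ (hinv ξ hξM)
    hθ₁pos.le (by linarith) hdist
  refine ⟨Ω₀, hQ0, ?_, hd.trans hθ₁θ⟩
  -- energy bookkeeping: `(1 - θ₁)⁻¹ (E₀ + δ) ≤ (1 + 2θ₁)(E₀ + δ) ≤ E₀ + s + s ≤ E₀ + δ'`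
  have hinv_le : (ENNReal.ofReal (1 - θ₁))⁻¹ ≤ 1 + ENNReal.ofReal (2 * θ₁) := by
    rw [← ENNReal.ofReal_inv_of_pos (by linarith), ← ENNReal.ofReal_one,
      ← ENNReal.ofReal_add zero_le_one (by linarith)]
    refine ENNReal.ofReal_le_ofReal ?_
    rw [inv_eq_one_div, div_le_iff₀ (by linarith)]
    nlinarith
  have h2θ : ENNReal.ofReal (2 * θ₁) * (periodicGroundStateEnergy v M L + min δ₀ s) ≤ s :=
    calc ENNReal.ofReal (2 * θ₁) * (periodicGroundStateEnergy v M L + min δ₀ s) ≤ q * K := by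
          refine mul_le_mul' ?_ (add_le_add le_rfl ((min_le_right _ _).trans hs1))
          rw [← ENNReal.ofReal_toReal hqtop]
          exact ENNReal.ofReal_le_ofReal hθ₁q
      _ = s := ENNReal.div_mul_cancel hK0 hKtop
  calc periodicEnergy v Ω₀ ≤ (ENNReal.ofReal (1 - θ₁))⁻¹ * periodicEnergy v Ω := hEΩ₀
    _ ≤ (1 + ENNReal.ofReal (2 * θ₁)) * (periodicGroundStateEnergy v M L + min δ₀ s) :=
        mul_le_mul' hinv_le hΩ
    _ = (periodicGroundStateEnergy v M L + min δ₀ s) +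
          ENNReal.ofReal (2 * θ₁) * (periodicGroundStateEnergy v M L + min δ₀ s) := by
        rw [add_mul, one_mul]
    _ ≤ (periodicGroundStateEnergy v M L + s) + s := add_le_add (add_le_add le_rfl (min_le_right _ _)) h2θ
    _ = periodicGroundStateEnergy v M L + min δ' 1 := by rw [add_assoc, hs, ENNReal.add_halves]
    _ ≤ periodicGroundStateEnergy v M L + δ' := add_le_add le_rfl (min_le_left _ _)

end Summit.AtomisticToContinuum.BoseEinsteinCondensation.Theorems

end
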